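import Literature.MathematicalPhysics.QuantumManyBody.SwapPurity
import Mathlib.MeasureTheory.Measure.WithDensity
import HarnessLib

/-!
# Route `BECThomsonPrinciple`, crux `PeriodicToDirichlet` (stmt-AtomisticToContinuum-9483),
# line `entropy-swap` — stub `stub_swapPurityDisintegration`: the swap purity as a two-bath expectation

For an `(n+1)`-body wave function `Ψ ∈ L²((ℝ³)^{n+1})` write `ψ_Y = Ψ(· :: Y)` for the slice at fixed
last `n` coordinates `Y ∈ (ℝ³)ⁿ`, `m(Y) = ‖ψ_Y‖₂² = ∫ |Ψ(x :: Y)|² dx` for the bath density and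
`K(Y, Y') = ⟨ψ_{Y'}, ψ_Y⟩ = ∫ conj Ψ(x :: Y') Ψ(x :: Y) dx` for the slice pairing. The swap purity
(`Literature.MathematicalPhysics.QuantumManyBody.BoseGas.swapPurity`, Penrose–Onsager's `A₂ = tr γ_Ψ²/N²`)
is `∫∫ |K(Y, Y')|² dY dY'` (`swapPurity_eq_lintegral_lintegral`). This file proves its
DISINTEGRATION over two independent baths drawn from the bath law `Q = m(Y) dY`:

  `swapPurity n Ψ = ∫ dQ(Y) ∫ dQ(Y') σ_Ψ(Y, Y')`,
  `σ_Ψ(Y, Y') = |K(Y, Y')|² / (m(Y) m(Y'))` (`0/0 = 0`),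

i.e. `tr ρ₁² = E_{Q⊗Q}[σ_Ψ]` with the bounded "conditional overlap" `σ_Ψ ∈ [0, 1]` — the form in which
the line `entropy-swap` transports the swap purity across boundary conditions by an entropy
inequality. The statement is `stub_swapPurityDisintegration`, registered verbatim in the lead's
skeleton (its `bathMeasure` / `condOverlap` unfolded into `volume.withDensity m` and the fraction).

Proof: unfold both `withDensity` integrals (`lintegral_withDensity_eq_lintegral_mul_non_measurable`,
legitimate because `m` is measurable and, by the `L²` hypothesis and Tonelli `∫ m = ‖Ψ‖₂² < ∞`,
finite a.e.), pull the outer density inside (`lintegral_const_mul'`, again for `m(Y) < ∞`), and cancel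
`m(Y) m(Y') · (|K|²/(m(Y) m(Y'))) = |K|²` for a.e. `(Y, Y')`: where a slice norm vanishes the slice is
`0` a.e. and so is the pairing `K`, elsewhere `0 < m(Y) m(Y') < ∞`. Without the `L²` hypothesis the
identity is false (on `{m = ∞}` the right-hand side loses the mass of `|K|²`), which is why it is there.

Nothing here is specific to the route beyond the statement's shape; no named facts are used.
-/

noncomputable section

namespace Summit.AtomisticToContinuum.BoseEinsteinCondensation.EntropySwap

open Literature.MathematicalPhysics.QuantumManyBody.BoseGas
open MeasureTheory
open scoped ENNReal NNReal ComplexConjugate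

/-- If the slice `ψ_Y = Ψ(· :: Y)` has `‖ψ_Y‖₂ = 0`, every pairing `⟨ψ_{Y'}, ψ_Y⟩` vanishes
(the slice is `0` a.e., hence so is the integrand). [folklore] -/
theorem integral_conj_mul_vecCons_eq_zero_of_right {n : ℕ} {Ψ : Config (n + 1) → ℂ}
    (hΨ : Measurable Ψ) (Y Y' : Config n)
    (h0 : ∫⁻ x, (‖Ψ (Matrix.vecCons x Y)‖₊ : ℝ≥0∞) ^ 2 = 0) :
    ∫ x, conj (Ψ (Matrix.vecCons x Y')) * Ψ (Matrix.vecCons x Y) = 0 := by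
  have hae : ∀ᵐ x : Space, Ψ (Matrix.vecCons x Y) = 0 := by
    have h := (lintegral_eq_zero_iff
      ((measurable_comp_vecCons_left hΨ Y).nnnorm.coe_nnreal_ennreal.pow_const 2)).1 h0
    filter_upwards [h] with x hx
    simpa using hx
  refine integral_eq_zero_of_ae ?_
  filter_upwards [hae] with x hx
  simp [hx]

/-- If the slice `ψ_{Y'} = Ψ(· :: Y')` has `‖ψ_{Y'}‖₂ = 0`, every pairing `⟨ψ_{Y'}, ψ_Y⟩` vanishes
(the slice is `0` a.e., hence so is the integrand). [folklore] -/
theorem integral_conj_mul_vecCons_eq_zero_of_left {n : ℕ} {Ψ : Config (n + 1) → ℂ}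
    (hΨ : Measurable Ψ) (Y Y' : Config n)
    (h0 : ∫⁻ x, (‖Ψ (Matrix.vecCons x Y')‖₊ : ℝ≥0∞) ^ 2 = 0) :
    ∫ x, conj (Ψ (Matrix.vecCons x Y')) * Ψ (Matrix.vecCons x Y) = 0 := by
  have hae : ∀ᵐ x : Space, Ψ (Matrix.vecCons x Y') = 0 := by
    have h := (lintegral_eq_zero_iff
      ((measurable_comp_vecCons_left hΨ Y').nnnorm.coe_nnreal_ennreal.pow_const 2)).1 h0
    filter_upwards [h] with x hx
    simpa using hx
  refine integral_eq_zero_of_ae ?_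
  filter_upwards [hae] with x hx
  simp [hx]

/-- Pointwise cancellation behind the disintegration: for slices of finite norm,
`m(Y) · (m(Y') · (|K(Y,Y')|² / (m(Y) m(Y')))) = |K(Y,Y')|²`, the degenerate cases `m(Y) = 0` or
`m(Y') = 0` holding because then `K(Y, Y') = 0`. [folklore] -/
theorem lintegral_mul_condOverlap_cancel {n : ℕ} {Ψ : Config (n + 1) → ℂ} (hΨ : Measurable Ψ)
    (Y Y' : Config n) (hY : ∫⁻ x, (‖Ψ (Matrix.vecCons x Y)‖₊ : ℝ≥0∞) ^ 2 ≠ ⊤)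
    (hY' : ∫⁻ x, (‖Ψ (Matrix.vecCons x Y')‖₊ : ℝ≥0∞) ^ 2 ≠ ⊤) :
    (∫⁻ x, (‖Ψ (Matrix.vecCons x Y)‖₊ : ℝ≥0∞) ^ 2) *
        ((∫⁻ x, (‖Ψ (Matrix.vecCons x Y')‖₊ : ℝ≥0∞) ^ 2) *
          ((‖∫ x, conj (Ψ (Matrix.vecCons x Y')) * Ψ (Matrix.vecCons x Y)‖₊ : ℝ≥0∞) ^ 2 /
            ((∫⁻ x, (‖Ψ (Matrix.vecCons x Y)‖₊ : ℝ≥0∞) ^ 2) *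
              ∫⁻ x, (‖Ψ (Matrix.vecCons x Y')‖₊ : ℝ≥0∞) ^ 2))) =
      (‖∫ x, conj (Ψ (Matrix.vecCons x Y')) * Ψ (Matrix.vecCons x Y)‖₊ : ℝ≥0∞) ^ 2 := by
  rw [← mul_assoc]
  refine ENNReal.mul_div_cancel' (fun h0 => ?_) (fun htop => ?_)
  · rcases mul_eq_zero.1 h0 with h | h
    · rw [integral_conj_mul_vecCons_eq_zero_of_right hΨ Y Y' h]
      simp
    · rw [integral_conj_mul_vecCons_eq_zero_of_left hΨ Y Y' h]
      simp
  · exact absurd htop (ENNReal.mul_ne_top hY hY')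

/-- **Disintegration of the swap purity over two independent baths** (stub
`stub_swapPurityDisintegration` of the line `entropy-swap`, crux `PeriodicToDirichlet`): for a
measurable `Ψ ∈ L²((ℝ³)^{n+1})`, with bath law `Q = (∫ |Ψ(x :: Y)|² dx) dY` and conditional overlap
`σ_Ψ(Y, Y') = |⟨ψ_{Y'}, ψ_Y⟩|² / (‖ψ_Y‖₂² ‖ψ_{Y'}‖₂²)`,
`swapPurity n Ψ = ∫ dQ(Y) ∫ dQ(Y') σ_Ψ(Y, Y')` (`tr γ_Ψ²/N² = E_{Q⊗Q}[σ_Ψ]`). Tonelli plus the a.e.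
cancellation `lintegral_mul_condOverlap_cancel`; the `L²` hypothesis makes `{‖ψ_Y‖₂ = ∞}` null.
[folklore] -/
theorem stub_swapPurityDisintegration :
    ∀ (n : ℕ) (Ψ : Config (n + 1) → ℂ), Measurable Ψ → (∫⁻ X, (‖Ψ X‖₊ : ℝ≥0∞) ^ 2) ≠ ⊤ →
      swapPurity n Ψ =
        ∫⁻ Y, ∫⁻ Y',
          (‖∫ x, (starRingEnd ℂ) (Ψ (Matrix.vecCons x Y')) * Ψ (Matrix.vecCons x Y)‖₊ : ℝ≥0∞) ^ 2 /
            ((∫⁻ x, (‖Ψ (Matrix.vecCons x Y)‖₊ : ℝ≥0∞) ^ 2) *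
              ∫⁻ x, (‖Ψ (Matrix.vecCons x Y')‖₊ : ℝ≥0∞) ^ 2)
          ∂(volume.withDensity fun Y => ∫⁻ x, (‖Ψ (Matrix.vecCons x Y)‖₊ : ℝ≥0∞) ^ 2)
          ∂(volume.withDensity fun Y => ∫⁻ x, (‖Ψ (Matrix.vecCons x Y)‖₊ : ℝ≥0∞) ^ 2) := by
  intro n Ψ hΨ hfin
  -- the bath density `m(Y) = ‖ψ_Y‖₂²`: measurable, of total mass `‖Ψ‖₂² < ∞`, hence finite a.e.
  have hmm : Measurable fun Y : Config n =>
      ∫⁻ x : Space, (‖Ψ (Matrix.vecCons x Y)‖₊ : ℝ≥0∞) ^ 2 :=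
    measurable_lintegral_sq_nnnorm_vecCons hΨ
  have hae : ∀ᵐ Y : Config n, (∫⁻ x : Space, (‖Ψ (Matrix.vecCons x Y)‖₊ : ℝ≥0∞) ^ 2) < ⊤ :=
    ae_lt_top hmm (by rwa [lintegral_lintegral_sq_nnnorm_vecCons hΨ])
  -- unfold the outer `withDensity` integral
  rw [swapPurity_eq_lintegral_lintegral hΨ,
    lintegral_withDensity_eq_lintegral_mul_non_measurable _ hmm hae]
  refine lintegral_congr_ae ?_
  filter_upwards [hae] with Y hY
  -- unfold the inner one and pull `m(Y) < ∞` inside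
  simp only [Pi.mul_apply]
  rw [lintegral_withDensity_eq_lintegral_mul_non_measurable _ hmm hae,
    ← lintegral_const_mul' _ _ hY.ne]
  refine lintegral_congr_ae ?_
  filter_upwards [hae] with Y' hY'
  simp only [Pi.mul_apply]
  exact (lintegral_mul_condOverlap_cancel hΨ Y Y' hY.ne hY'.ne).symm

end Summit.AtomisticToContinuum.BoseEinsteinCondensation.EntropySwap

end
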